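/-
Copyright (c) 2026 the pub-hodgecm-mathlib formalisation cell (harness21).  Prover seat hodgecm-mathlib-K2Liu-p08 (g6), Track B «K2-LIT»,
#184♮ = hLiu418 = `stmt-HodgeConjecture-24832`; #42S BLOCK D, row D-2, (σ-A) mini-road (LEAD F0P6-plan (g15) RULING M-160f; (σ-A) road desk K2Liu-p25 (g3)
WORD #51 «(an-3c) §3b cut (A)(B)(C)(D)»), piece (A): THE OUTER STAGE — the `y`-stage integral of the local Siegel–Weil section along the long-root corner is
`c · ∫ VEC_g(s ⊔ 0) dσ(s)` against the null-cone Radon measure of the corner's phase.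
THEOREMS ONLY (no `def`, no `instance`, no `notation`, no named-fact hypothesis, no `sorry`).
-/
import Summits.HodgeConjecture.HodgeConjecture.Theorems.K2LiuLocalSWCornerActionWordsYStage   -- ★ p864240 [A1]: the y-stage corner pair by name
import Summits.HodgeConjecture.HodgeConjecture.Theorems.K2LiuTensorMiddleCellPhaseTrace       -- ★ (C3-d): `halfForm_cOfFix_boxConj_eq_half_im_trace`
import Summits.HodgeConjecture.HodgeConjecture.Theorems.K2LiuTensorMiddleCellSiegelLetters    -- ★ `exists_blockSkew`
import Summits.HodgeConjecture.HodgeConjecture.Theorems.K2LiuLocalPiPartialFourierSplitting   -- ★ p864180 [A2]: `sliceR_mem_schwartzBruhat` (slices of `𝒮`)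
import Literature.NumberTheory.Automorphic.QuadraticRestrictionOfScalars                      -- ★ `isQuadraticCoordinates_local` (`im (ι y · z) = y · im z`)
import Literature.RepresentationTheory.HeisenbergGroup.QuasiInvariantFunctionalSiegelTransport   -- ★ `exists_quadraticForm_coe_eq` (ED. 2 §3)
import HarnessLib

/-!
# Crux `HLiu418`, #42S BLOCK D, row D-2, (σ-A) brick (an-3c) §3b piece (A): THE OUTER STAGE —
# `∫_y F_Φ(φ(w₂)·φ(u_{2e₂}(ι y·δ))·g) dμ(y) = c · ∫ VEC_g(s ⊔ 0) dσ(s)`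

Cell `hodgecm-mathlib`, crux item hLiu418 = `stmt-HodgeConjecture-24832`; squad K2 ∕ K2Liu; prover K2Liu-p08 (g6).  Lane `--supports stmt-HodgeConjecture-24832
--as helper` (count-neutral helper; closes no socket).

WHY.  In the telescope of ★ p864562 `coneWord_of_stageLetters` the letter (L2) reads `N₁ x ζ = c_F · ∫ V_x((Z_s ζ) ⊔ s) dσ(s)`.  Its OUTER half is this file:
★ p864240 [A1] writes the `y`-stage value of the local Siegel–Weil section `F_Φ = swSectionTensorLoc … Φ` along the corner `φ(w₂)·φ(u_{2e₂}(x))·g`, `x = ι(y)·δ`,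
as `c · ∫_{X₁} (unipOpPi c_{t′_y} VEC_g)(x₁ ⊔ 0) dμ^{M₂+M₂}` with ONE `c ≠ 0`; ★ Rao `coe_unipOpPi_apply` makes the integrand `ψ_v(−halfForm c_{t′_y}(x₁ ⊔ 0))·VEC_g(x₁ ⊔ 0)`;
★ (C3-d) `halfForm_cOfFix_boxConj_eq_half_im_trace` reads the phase as `⅟2·im(2·tr(gramS₂ · t_y · G̃(x₁ ⊔ 0)))` with `t_y = (0 0; 0 ι(d₂)·ι(y)·δ) = ι(y) • t_δ`, so the
phase is `y · Qc(x₁)` for the `y`-FREE second-degree function `Qc(x₁) := −⅟2·im(2·tr(gramS₂ · t_δ · G̃(x₁ ⊔ 0)))` (§1, `im` is `L⁺_v`-linear: ★ `isQuadraticCoordinates_local`);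
and the null-cone Radon measure `σ` of `Qc` (★ p864508 (an-1) B `exists_nullConeMeasure`, here BY VALUE through its clause (1)
`∫ Ψ dσ = ∫_y ∫_{x₁} Ψ(x₁)·ψ_v(y·Qc x₁) dμ^{M₂+M₂} dμ` for `Ψ ∈ 𝒮`) swallows the `y`-integral: with `Ψ := VEC_g(· ⊔ 0) ∈ 𝒮` (★ [A2] slices)
**`∫_y F_Φ(φ(w₂)·φ(u_{2e₂}(ι y·δ))·g) dμ(y) = c · ∫ VEC_g(s ⊔ 0) dσ(s)`** for every `g`, `Φ` (§2) — no Fubini is used (clause (1) IS the iterated integral in this order).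
* §1 `neg_halfForm_cOfFix_boxConj_eq_mul` — the phase of the block-side skew keyed on `(0 0; 0 ι(d₂)·ι(y)·δ)` is `y · Qc`;
* §2 **`exists_ne_zero_integral_yStage_eq_integral_cone`** — the outer stage.
BY VALUE here, paid in (D) `K2LiuStageFunctionalConeWordRecord`: `σ` with clause (1) for `Qc` (needs `Qc` as a `QuadraticForm` with separating polar form — (D));
the inner reading `VEC_g(s ⊔ 0) = c_F′ · V_x((Z_s ζ) ⊔ s)` is piece (B) `K2LiuConeGraphReading` (K2Liu-p09 (g9)).
HONEST LABEL.  `HC_CM` is proved only modulo the 7 printed citations (2 remaining named inputs: hLiu418 = `stmt-HodgeConjecture-24832`,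
h413 = `stmt-HodgeConjecture-24833`) until rung 0 closes; count-neutral helper, closes no socket.

## References
* [Rangarao1993] R. Ranga Rao, Pacific J. Math. 157 (1993), Lemma 3.2 (3.8), p. 351.   * [Kudla1994] S. S. Kudla, Israel J. Math. 87 (1994), §3 Thm. 3.1.
* [Weil1965] A. Weil, Acta Math. 113 (1965), Chap. I n° 2 Lemme 3; Chap. III n° 36 Prop. 6.   * [KudlaRallis1994] S. Kudla, S. Rallis, Ann. of Math. 140 (1994), §2, §5 (5.3)–(5.6).
* [HarrisKudlaSweet1996] M. Harris, S. Kudla, W. J. Sweet, J. Amer. Math. Soc. 9 (1996), §1 (1.11)–(1.12), (1.15).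
-/

set_option autoImplicit false
set_option linter.dupNamespace false -- the mandated namespace repeats `HodgeConjecture.HodgeConjecture`

noncomputable section

open scoped Matrix Kronecker
open NumberField IsDedekindDomain MeasureTheory Matrix
open Literature.RepresentationTheory.HeisenbergGroup Literature.RepresentationTheory.HeisenbergGroup.SymplecticMatrix
open Literature.NumberTheory.Automorphic Literature.NumberTheory.Automorphic.UnitaryGroup Literature.NumberTheory.Weil1964
open Literature.NumberTheory.Automorphic.UnitaryGroup.QuadraticCoordinates
open Literature.NumberTheory.GaloisRepresentations Literature.NumberTheory.GaloisRepresentations.IsNonarchimedeanLocalField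
open Literature.RepresentationTheory.HarrisKudlaSweet1996
open Literature.NumberTheory.GelbartRogawski1991 Literature.NumberTheory.GelbartRogawski1991.GRConstruction
open Literature.NumberTheory.GelbartRogawski1991.AdaptedBlocks
open Literature.NumberTheory.GelbartRogawski1991.UnitaryDualPair
open Literature.NumberTheory.GelbartRogawski1991.UnitaryDualPair.LocalSplitting
open Literature.NumberTheory.GelbartRogawski1991.UnitaryDualPair.LocalSplitting.FrameTransport
open Literature.NumberTheory.GelbartRogawski1991.UnitaryDualPair.LocalSplitting.DoubledBlock
open Literature.NumberTheory.K2Lit.SiegelDoubled Literature.NumberTheory.K2Lit.LocalSiegelDoubled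
open Summit.HodgeConjecture.HodgeConjecture.Cruxes.HLiu418.K2LiuLocalSWSectionDefs
open Summit.HodgeConjecture.HodgeConjecture.Cruxes.HLiu418.K2LiuLocalSWTensorBlockTransport
open Summit.HodgeConjecture.HodgeConjecture.Cruxes.HLiu418.K2LiuLocalSWTensorBlockFrame
open Summit.HodgeConjecture.HodgeConjecture.Cruxes.HLiu418.K2LiuLocalSWTensorBigCellLetters
open Summit.HodgeConjecture.HodgeConjecture.Cruxes.HLiu418.K2LiuLocalSiegelIwasawa (antidiagonal_over_eq_map)
open Summit.HodgeConjecture.HodgeConjecture.Cruxes.HLiu418.K2LiuDoubledUTwoTwoBorelFrame (uLongTwo)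
open Summit.HodgeConjecture.HodgeConjecture.Cruxes.HLiu418.K2LiuDoubledUTwoTwoWeylCocycle (weylTwo)
open Summit.HodgeConjecture.HodgeConjecture.Cruxes.HLiu418.K2LiuDoubledUTwoTwoFrameTransport (toLocalFour)
open Summit.HodgeConjecture.HodgeConjecture.Cruxes.HLiu418.K2LiuLocalSWCornerActionWordsYStage
open Summit.HodgeConjecture.HodgeConjecture.Cruxes.HLiu418.K2LiuTensorMiddleCellPhaseTrace (halfForm_cOfFix_boxConj_eq_half_im_trace)
open Summit.HodgeConjecture.HodgeConjecture.Cruxes.HLiu418.K2LiuTensorMiddleCellSiegelLetters (exists_blockSkew)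
open Summit.HodgeConjecture.HodgeConjecture.Cruxes.HLiu418.K2LiuLocalPiPartialFourierSplitting (sliceR_mem_schwartzBruhat glue_sumComm)

namespace Summit.HodgeConjecture.HodgeConjecture.Cruxes.HLiu418.K2LiuConeOuterStage

variable (L : Type) [Field L] [NumberField L] [IsCMField L]
variable {N M : ℕ} (e : Fin N × Fin M ≃ Fin 2)
  (dV : Fin N → L) (hdV : ∀ i, IsCMField.complexConj L (dV i) = dV i)
  (dW : Fin M → L) (hdW : ∀ i, IsCMField.complexConj L (dW i) = dW i)
variable {M₂ M' : ℕ} (eW : Fin M × Fin M₂ ≃ Fin M') (e' : Fin N × Fin M' ≃ Fin (M₂ + M₂))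
  (dV' : Fin M₂ → L) (hdV' : ∀ k, IsCMField.complexConj L (dV' k) = dV' k)
  (v : HeightOneSpectrum (𝓞 (Fp L)))
  [MeasurableSpace (v.adicCompletion (Fp L))] [BorelSpace (v.adicCompletion (Fp L))]
  (μ : Measure (v.adicCompletion (Fp L))) [μ.IsAddHaarMeasure]
  (χ : HeckeCharacter L) (hχ : IsSplittingChar L 1 χ)
  -- the antidiagonal frame of the small doubled group `U(𝕍^𝔻)(L⁺_v)` ([A1-mat])
  (D Dinv : Matrix (Fin 2) (Fin 2) (Fp L)) (hDD : D * Dinv = 1) (Q : GL (Fin (2 + 2)) (Fp L))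
  (hQm : (Q : Matrix (Fin (2 + 2)) (Fin (2 + 2)) (Fp L)) = Matrix.reindex (e₂ 2) (e₂ 2) (Matrix.fromBlocks 1 D 1 (-D)))
  (hQ : (Q : Matrix (Fin (2 + 2)) (Fin (2 + 2)) (Fp L))ᵀ * gramD (Fp L) 2 (gramR L e dV hdV dW hdW) * (Q : Matrix (Fin (2 + 2)) (Fin (2 + 2)) (Fp L)) =
    (StdForm.antidiagonal (2 + 2)).over (Fp L))
  {d₁ d₂ d₁' d₂' : Fp L} (hDa : D = !![0, d₁; d₂, 0]) (hDia : Dinv = !![0, d₁'; d₂', 0])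
  -- a flip of the second line (★ `exists_flip_single_hermD … 1`)
  {w₁ : UnitaryGroup.localPi L (IsCMField.complexConj L) (2 + 2) (hermD L e dV hdV dW hdW) v}
  (hw₁ : adapt (matA (Fp L) L (IsCMField.complexConj L) v 2 w₁) =
    Matrix.fromBlocks (1 - Matrix.single 1 1 1) (Matrix.single 1 1 1) (Matrix.single 1 1 1) (1 - Matrix.single 1 1 1))
  -- the K1a letter's anti-invariant generator `δ` (`u(yδ)`)
  {δ : L} (hcδ : IsCMField.complexConj L δ = -δ)

/-! ## §1 The phase of the corner skew `(0 0; 0 ι(d₂)·ι(y)·δ)` is `y` times the phase at `y = 1` -/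

omit [MeasurableSpace (v.adicCompletion (Fp L))] [BorelSpace (v.adicCompletion (Fp L))] in
include hcδ in
/-- `ι(y)·δ` is anti-invariant: `σ(ι(y)·δ) = −ι(y)·δ` (★ `conjLocal_toLocalRing`, `conjLocal_algebraMap`). [cite: CasselsFrohlichANT1967, Ch. II §10] -/
theorem conjLocal_toLocalRing_mul_delta (y : v.adicCompletion (Fp L)) :
    UnitaryGroup.conjLocal L (IsCMField.complexConj L) v (UnitaryGroup.toLocalRing L v y * algebraMap L (UnitaryGroup.LocalRing L v) δ) =
      -(UnitaryGroup.toLocalRing L v y * algebraMap L (UnitaryGroup.LocalRing L v) δ) := by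
  rw [map_mul, conjLocal_toLocalRing, conjLocal_algebraMap, hcδ, map_neg, mul_neg]

omit [IsCMField L] [MeasurableSpace (v.adicCompletion (Fp L))] [BorelSpace (v.adicCompletion (Fp L))] in
/-- the corner skew is `ι(y)`-homogeneous: `(0 0; 0 a·(ι(y)·b)) = ι(y) • (0 0; 0 a·b)`. [folklore] -/
theorem cornerSkew_eq_smul (a b : UnitaryGroup.LocalRing L v) (y : v.adicCompletion (Fp L)) :
    (!![0, 0; 0, a * (UnitaryGroup.toLocalRing L v y * b)] : Matrix (Fin 2) (Fin 2) (UnitaryGroup.LocalRing L v)) =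
      UnitaryGroup.toLocalRing L v y • !![0, 0; 0, a * b] := by
  ext i j : 1
  fin_cases i <;> fin_cases j <;> simp [mul_left_comm]

omit [MeasurableSpace (v.adicCompletion (Fp L))] [BorelSpace (v.adicCompletion (Fp L))] in
set_option maxHeartbeats 4000000 in -- MEASURED class of ★ (C3-d) `halfForm_cOfFix_boxConj_eq_half_im_trace` (800000 RED there; the `frameMp` letters)
/-- **THE CORNER PHASE IS `y · Qc`.**  For the block-side skew `tb` keyed (`hPX`) on the corner skew `t_y = (0 0; 0 ι(d₂)·ι(y)·δ)` of `φ(u_{2e₂}(ι y·δ))` conjugated by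
`w₁·φ(w₂)` (★ [A1] `blkA_mul_uLongTwoBlock_mul_blkD_inv`), the Rao phase at ANY point `z` is `y` times the `y`-free reading at `t_δ = (0 0; 0 ι(d₂)·δ)`:
`−halfForm (mulVecLin c_{tb}) z = y · (−⅟2·im(2·tr(gramS₂ · t_δ · G̃(z))))` — ★ (C3-d) `halfForm_cOfFix_boxConj_eq_half_im_trace` at `t_y = ι(y) • t_δ`, then
`im(ι(y)·w) = y·im(w)` (★ `isQuadraticCoordinates_local`). [cite: Rangarao1993, Lemma 3.2 (3.8), p. 351] [cite: Kudla1994, §3 Thm. 3.1] -/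
theorem neg_halfForm_cOfFix_boxConj_eq_mul
    {T₁ T₂ : Matrix (Fin M₂) (Fin M₂) (Fp L)} (hT₁ : T₁.IsSymm) (hT₂ : T₂.IsSymm)
    (P : GL (Fin (M₂ + M₂)) (Fp L))
    (hP : ((P : Matrix (Fin (M₂ + M₂)) (Fin (M₂ + M₂)) (Fp L)))ᵀ *
        gramR L e' dV hdV (tensorFrame L dW eW dV') (tensorFrame_real L dW hdW eW dV' hdV') * (P : Matrix _ _ (Fp L)) =
      UnitaryGroup.finSum M₂ M₂ T₁ T₂)
    {PD : GL (Fin ((M₂ + M₂) + (M₂ + M₂))) (Fp L)} (hPD : PD = UnitaryGroup.reindexGL (e₂ (M₂ + M₂)) (UnitaryGroup.blockDiagGL (P, P)))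
    (m : LocalMp (Fp L) ((M₂ + M₂) + (M₂ + M₂)) (gramD (Fp L) (M₂ + M₂) (UnitaryGroup.finSum M₂ M₂ T₁ T₂)) v)
    (y : v.adicCompletion (Fp L))
    (ht : ((!![0, 0; 0, (UnitaryGroup.toLocalRing L v).comp (algebraMap (Fp L) (v.adicCompletion (Fp L))) d₂ *
            (UnitaryGroup.toLocalRing L v y * algebraMap L (UnitaryGroup.LocalRing L v) δ)] : Matrix (Fin 2) (Fin 2) (UnitaryGroup.LocalRing L v)).map
          (conjLocal L (IsCMField.complexConj L) v))ᵀ * gramS (Fp L) L v 2 (gramR L e dV hdV dW hdW) +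
        gramS (Fp L) L v 2 (gramR L e dV hdV dW hdW) *
          !![0, 0; 0, (UnitaryGroup.toLocalRing L v).comp (algebraMap (Fp L) (v.adicCompletion (Fp L))) d₂ *
            (UnitaryGroup.toLocalRing L v y * algebraMap L (UnitaryGroup.LocalRing L v) δ)] = 0)
    (tb : Matrix (Fin (M₂ + M₂)) (Fin (M₂ + M₂)) (LocalRing L v))
    (htb : (tb.map (conjLocal L (IsCMField.complexConj L) v))ᵀ * gramS (Fp L) L v (M₂ + M₂) (UnitaryGroup.finSum M₂ M₂ T₁ T₂) +
      gramS (Fp L) L v (M₂ + M₂) (UnitaryGroup.finSum M₂ M₂ T₁ T₂) * tb = 0)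
    (hPX : (P : Matrix (Fin (M₂ + M₂)) (Fin (M₂ + M₂)) (Fp L)).map ((UnitaryGroup.toLocalRing L v).comp (algebraMap (Fp L) (v.adicCompletion (Fp L)))) * tb *
      ((P⁻¹ : GL (Fin (M₂ + M₂)) (Fp L)) : Matrix (Fin (M₂ + M₂)) (Fin (M₂ + M₂)) (Fp L)).map
        ((UnitaryGroup.toLocalRing L v).comp (algebraMap (Fp L) (v.adicCompletion (Fp L)))) =
      Matrix.reindex (epsV e eW e') (epsV e eW e')
        ((!![0, 0; 0, (UnitaryGroup.toLocalRing L v).comp (algebraMap (Fp L) (v.adicCompletion (Fp L))) d₂ *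
            (UnitaryGroup.toLocalRing L v y * algebraMap L (UnitaryGroup.LocalRing L v) δ)] : Matrix (Fin 2) (Fin 2) (UnitaryGroup.LocalRing L v)) ⊗ₖ
          (1 : Matrix (Fin M₂) (Fin M₂) (LocalRing L v))))
    (z : Fin ((M₂ + M₂) + (M₂ + M₂)) → v.adicCompletion (Fp L)) :
    -halfForm (Matrix.mulVecLin (cOfFix (localGram (Fp L) ((M₂ + M₂) + (M₂ + M₂)) (gramD (Fp L) (M₂ + M₂) (UnitaryGroup.finSum M₂ M₂ T₁ T₂)) v)
        (MpPsi.proj _ m *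
          iotaD (Fp L) L (IsCMField.complexConj L) (complexConj_imagUnit L) (imagUnit_ne_zero L) (imagUnit_mul_self L) v
            (M₂ + M₂) (UnitaryGroup.isSymm_finSum hT₁ hT₂) rfl
            (nElem (Fp L) L (IsCMField.complexConj L) v (M₂ + M₂) (T₀ := UnitaryGroup.finSum M₂ M₂ T₁ T₂) rfl tb htb) *
          (MpPsi.proj _ m)⁻¹))) z =
      y * -(⅟(2 : v.adicCompletion (Fp L)) *
        im (quadraticLocalEquiv L v (IsCMField.complexConj L) (complexConj_imagUnit L) (imagUnit_ne_zero L)).toLinearEquiv.toAddEquiv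
          (2 * Matrix.trace (gramS (Fp L) L v 2 (gramR L e dV hdV dW hdW) *
            !![0, 0; 0, (UnitaryGroup.toLocalRing L v).comp (algebraMap (Fp L) (v.adicCompletion (Fp L))) d₂ * algebraMap L (UnitaryGroup.LocalRing L v) δ] *
            Matrix.of fun j i => ∑ k, ∑ l,
              halfDiff ((eD (Fp L) L (IsCMField.complexConj L) (complexConj_imagUnit L) (imagUnit_ne_zero L) (imagUnit_mul_self L) v (M₂ + M₂)).symm
                  (toLin (Fp L) v
                    (MpPsi.proj _ (frameMp (Fp L) v ((M₂ + M₂) + (M₂ + M₂)) PD (transpose_pd_mul_gramD_mul_pd (Fp L) (M₂ + M₂) P hP hPD) m))⁻¹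
                    (frameLin (Fp L) v ((M₂ + M₂) + (M₂ + M₂)) PD z, 0))) (epsV e eW e' (j, l)) *
                gramS (Fp L) L v M₂ (realDiagonal L dV' hdV') k l *
                conjLocal L (IsCMField.complexConj L) v
                  (halfDiff ((eD (Fp L) L (IsCMField.complexConj L) (complexConj_imagUnit L) (imagUnit_ne_zero L) (imagUnit_mul_self L) v (M₂ + M₂)).symm
                    (toLin (Fp L) v
                      (MpPsi.proj _ (frameMp (Fp L) v ((M₂ + M₂) + (M₂ + M₂)) PD (transpose_pd_mul_gramD_mul_pd (Fp L) (M₂ + M₂) P hP hPD) m))⁻¹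
                      (frameLin (Fp L) v ((M₂ + M₂) + (M₂ + M₂)) PD z, 0))) (epsV e eW e' (i, k)))))) := by
  haveI : Algebra.IsQuadraticExtension (Fp L) L := IsCMField.isQuadraticExtension L
  rw [halfForm_cOfFix_boxConj_eq_half_im_trace L e dV hdV dW hdW eW e' dV' hdV' v hT₁ hT₂ P hP hPD m _ ht tb htb hPX z, cornerSkew_eq_smul L v,
    Matrix.mul_smul, Matrix.smul_mul, Matrix.trace_smul, smul_eq_mul, mul_left_comm (2 : UnitaryGroup.LocalRing L v),
    (isQuadraticCoordinates_local L v (IsCMField.complexConj L) (complexConj_imagUnit L) (imagUnit_ne_zero L) (imagUnit_mul_self L)).im_map_mul]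
  ring

/-! ## §2 The outer stage: the `y`-integral of the corner values is `c · ∫ VEC_g(s ⊔ 0) dσ(s)` -/

include hDD hQm hDa hDia hw₁ hcδ in
set_option maxHeartbeats 4000000 in -- MEASURED class of ★ p864240 [A1] (the section vector carries the tensor datum a second time)
/-- **THE OUTER STAGE.**  With ★ p864240's data VERBATIM (the tensor datum, the block frame `σ, P, PD`, the block data `p₁ hW₁ p₂`, the outer
mover-implementer `m₀`, the antidiagonal frame `(D, Dinv, Q)`, a flip `w₁` of the second line), the K1a letter's `δ` (`σδ = −δ`), a second-degree function `Qc`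
on the cone slot with the READING LETTER `hQc : Qc x₁ = −⅟2·im(2·tr(gramS₂ · t_δ · G̃_{j̃(p₁,p₂)}(x₁ ⊔ 0)))` (★ (C3-d) currency, `t_δ = (0 0; 0 ι(d₂)·δ)`), and a measure `ν`
on the cone slot carrying ★ p864508 (an-1) B's clause (1) for `Qc` (`∫ Ψ dν = ∫_y ∫_{x₁} Ψ(x₁)·ψ_v(y·Qc x₁)` on `𝒮`), there is ONE `c ≠ 0` with, for every `g`, `Φ`:
**`∫_y F_Φ(φ(w₂) · φ(u_{2e₂}(ι y·δ)) · g) dμ(y) = c · ∫ VEC_g(s ⊔ 0) dν(s)`**,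
`VEC_g = op(j̃(p₁,p₂)) (frameOp_{PD}⁻¹ (ω(s′(tensorEmbLoc ((w₁·φ(w₂))·g))) Φ))` — ★ p864240 pointwise in `y` (block-side skew by ★ `exists_blockSkew` on
★ `skew_cornerYBlock`), ★ `coe_unipOpPi_apply`, §1, then clause (1) at the slice `Ψ := VEC_g(· ⊔ 0) ∈ 𝒮` (★ `sliceL_mem_schwartzBruhat`); no Fubini.
[cite: Kudla1994, §3 Thm. 3.1] [cite: Rangarao1993, Lemma 3.2 (3.8), p. 351] [cite: Weil1965, Chap. I n° 2 Lemme 3] [cite: KudlaRallis1994, §5 (5.3)–(5.6)] -/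
theorem exists_ne_zero_integral_yStage_eq_integral_cone (hM₂ : 0 < M₂ + M₂)
    (hT₀d : IsUnit (gramR L e' dV hdV (tensorFrame L dW eW dV') (tensorFrame_real L dW hdW eW dV' hdV')).det)
    {σ : Equiv.Perm (Fin (M₂ + M₂))}
    (hσ₀ : ∀ k, σ (epsV e eW e' (1, k)) = finSumFinEquiv (Sum.inl k)) (hσ₁ : ∀ k, σ (epsV e eW e' (0, k)) = finSumFinEquiv (Sum.inr k))
    {T₁ T₂ : Matrix (Fin M₂) (Fin M₂) (Fp L)}
    (P : GL (Fin (M₂ + M₂)) (Fp L)) (hPσ : (P : Matrix (Fin (M₂ + M₂)) (Fin (M₂ + M₂)) (Fp L)) = σ.toPEquiv.toMatrix)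
    (hP : ((P : Matrix (Fin (M₂ + M₂)) (Fin (M₂ + M₂)) (Fp L)))ᵀ *
        gramR L e' dV hdV (tensorFrame L dW eW dV') (tensorFrame_real L dW hdW eW dV' hdV') * (P : Matrix _ _ (Fp L)) =
      UnitaryGroup.finSum M₂ M₂ T₁ T₂)
    (t' : Fin (M₂ + M₂) → Fp L) (hT' : UnitaryGroup.finSum M₂ M₂ T₁ T₂ = Matrix.diagonal t') (hT₀'d : IsUnit (UnitaryGroup.finSum M₂ M₂ T₁ T₂).det)
    {PD : GL (Fin ((M₂ + M₂) + (M₂ + M₂))) (Fp L)} (hPD : PD = UnitaryGroup.reindexGL (e₂ (M₂ + M₂)) (UnitaryGroup.blockDiagGL (P, P)))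
    (m₀ : LocalMp (Fp L) ((M₂ + M₂) + (M₂ + M₂))
      (gramD (Fp L) (M₂ + M₂) (gramR L e' dV hdV (tensorFrame L dW eW dV') (tensorFrame_real L dW hdW eW dV' hdV'))) v)
    (hm₀ : (deltaLagrangian (Fp L) v (M₂ + M₂)).map (toLin (Fp L) v (MpPsi.proj _ m₀)) = lagrangianY (Fp L) ((M₂ + M₂) + (M₂ + M₂)) v)
    (hM₂' : 0 < M₂) (t₁ : Fin M₂ → Fp L) (hT₁t : T₁ = Matrix.diagonal t₁) (hT₁ : T₁.IsSymm) (hT₂ : T₂.IsSymm)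
    (hT₁d : IsUnit T₁.det) (hT₂d : IsUnit T₂.det)
    (hTv₁ : IsUnit (localGram (Fp L) (M₂ + M₂) (gramD (Fp L) M₂ T₁) v).det)
    (p₁ : LocalMp (Fp L) (M₂ + M₂) (gramD (Fp L) M₂ T₁) v)
    (hp₁ : (deltaLagrangian (Fp L) v M₂).map (toLin (Fp L) v (MpPsi.proj _ p₁)) = lagrangianY (Fp L) (M₂ + M₂) v)
    (B₁ : GL (Fin (M₂ + M₂)) (v.adicCompletion (Fp L)))
    (hW₁ : MpPsi.proj _ p₁ * iotaD (Fp L) L (IsCMField.complexConj L) (complexConj_imagUnit L) (imagUnit_ne_zero L)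
        (imagUnit_mul_self L) v M₂ hT₁ rfl (weylDelta (Fp L) L (IsCMField.complexConj L) v M₂ (T₀ := T₁) rfl) * (MpPsi.proj _ p₁)⁻¹ =
      (transportSp (localGram (Fp L) (M₂ + M₂) (gramD (Fp L) M₂ T₁) v) hTv₁ (SymplecticGroup.symJ _ _))⁻¹ *
        transportSp (localGram (Fp L) (M₂ + M₂) (gramD (Fp L) M₂ T₁) v) hTv₁ (levi B₁))
    {m : ℤ} (hm : (adeleAddCharAt (Fp L) v).HasConductorExp m)
    (p₂ : LocalMp (Fp L) (M₂ + M₂) (gramD (Fp L) M₂ T₂) v)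
    (hp₂ : (deltaLagrangian (Fp L) v M₂).map (toLin (Fp L) v (MpPsi.proj _ p₂)) = lagrangianY (Fp L) (M₂ + M₂) v)
    -- the cone slot: the second-degree function `Qc` (reading letter) and a measure `ν` with (an-1) B clause (1) for it
    (Qc : (Fin (M₂ + M₂) → v.adicCompletion (Fp L)) → v.adicCompletion (Fp L))
    (hQc : ∀ x₁ : Fin (M₂ + M₂) → v.adicCompletion (Fp L), Qc x₁ =
      -(⅟(2 : v.adicCompletion (Fp L)) *
        im (quadraticLocalEquiv L v (IsCMField.complexConj L) (complexConj_imagUnit L) (imagUnit_ne_zero L)).toLinearEquiv.toAddEquiv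
          (2 * Matrix.trace (gramS (Fp L) L v 2 (gramR L e dV hdV dW hdW) *
            !![0, 0; 0, (UnitaryGroup.toLocalRing L v).comp (algebraMap (Fp L) (v.adicCompletion (Fp L))) d₂ * algebraMap L (UnitaryGroup.LocalRing L v) δ] *
            Matrix.of fun j i => ∑ k, ∑ l,
              halfDiff ((eD (Fp L) L (IsCMField.complexConj L) (complexConj_imagUnit L) (imagUnit_ne_zero L) (imagUnit_mul_self L) v (M₂ + M₂)).symm
                  (toLin (Fp L) v
                    (MpPsi.proj _ (frameMp (Fp L) v ((M₂ + M₂) + (M₂ + M₂)) PD (transpose_pd_mul_gramD_mul_pd (Fp L) (M₂ + M₂) P hP hPD)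
                      (boxLoc (Fp L) v M₂ M₂ (T₁ := T₁) (T₂ := T₂) (p₁, p₂))))⁻¹
                    (frameLin (Fp L) v ((M₂ + M₂) + (M₂ + M₂)) PD (glue (blkIdx M₂ M₂) x₁ 0), 0))) (epsV e eW e' (j, l)) *
                gramS (Fp L) L v M₂ (realDiagonal L dV' hdV') k l *
                conjLocal L (IsCMField.complexConj L) v
                  (halfDiff ((eD (Fp L) L (IsCMField.complexConj L) (complexConj_imagUnit L) (imagUnit_ne_zero L) (imagUnit_mul_self L) v (M₂ + M₂)).symm
                    (toLin (Fp L) v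
                      (MpPsi.proj _ (frameMp (Fp L) v ((M₂ + M₂) + (M₂ + M₂)) PD (transpose_pd_mul_gramD_mul_pd (Fp L) (M₂ + M₂) P hP hPD)
                        (boxLoc (Fp L) v M₂ M₂ (T₁ := T₁) (T₂ := T₂) (p₁, p₂))))⁻¹
                      (frameLin (Fp L) v ((M₂ + M₂) + (M₂ + M₂)) PD (glue (blkIdx M₂ M₂) x₁ 0), 0))) (epsV e eW e' (i, k)))))))
    (ν : Measure (Fin (M₂ + M₂) → v.adicCompletion (Fp L)))
    (hν : ∀ Ψ : (Fin (M₂ + M₂) → v.adicCompletion (Fp L)) → ℂ, Ψ ∈ SchwartzBruhat (Fin (M₂ + M₂) → v.adicCompletion (Fp L)) →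
      Integrable Ψ ν ∧ ∫ x, Ψ x ∂ν = ∫ β, ∫ x, Ψ x * ((adeleAddCharAt (Fp L) v (β * Qc x) : Circle) : ℂ)
        ∂(Measure.pi fun _ : Fin (M₂ + M₂) => μ) ∂μ) :
    ∃ c : ℂ, c ≠ 0 ∧ ∀ (g : UnitaryGroup.localPi L (IsCMField.complexConj L) (2 + 2) (hermD L e dV hdV dW hdW) v)
      (Φ : SchwartzBruhat (Fin ((M₂ + M₂) + (M₂ + M₂)) → v.adicCompletion (Fp L))),
      ∫ y : v.adicCompletion (Fp L),
        swSectionTensorLoc L e dV hdV dW hdW eW e' dV' hdV' v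
          (localSplittingDatumCM L v μ (M₂ + M₂)
            (gramR_isSymm L e' dV hdV (tensorFrame L dW eW dV') (tensorFrame_real L dW hdW eW dV' hdV')) hT₀d
            (hermD_eq_map_gramD L e' dV hdV (tensorFrame L dW eW dV') (tensorFrame_real L dW hdW eW dV' hdV')) χ hχ).localSplitting
          m₀ Φ
          (FrameTransport.frameConj (Fp L) L (IsCMField.complexConj L) v (2 + 2) (hermD_eq_map_gramD L e dV hdV dW hdW) (antidiagonal_over_eq_map (Fp L) L 2) Q hQ
              (toLocalFour (Fp L) L (IsCMField.complexConj L) v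
                (weylTwo (UnitaryGroup.LocalRing L v) (UnitaryGroup.conjLocal L (IsCMField.complexConj L) v))) *
            FrameTransport.frameConj (Fp L) L (IsCMField.complexConj L) v (2 + 2) (hermD_eq_map_gramD L e dV hdV dW hdW) (antidiagonal_over_eq_map (Fp L) L 2) Q hQ
              (toLocalFour (Fp L) L (IsCMField.complexConj L) v
                (uLongTwo (UnitaryGroup.LocalRing L v) (UnitaryGroup.conjLocal L (IsCMField.complexConj L) v)
                  (UnitaryGroup.toLocalRing L v y * algebraMap L (UnitaryGroup.LocalRing L v) δ) (conjLocal_toLocalRing_mul_delta L v hcδ y))) * g) ∂μ =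
        c * ∫ s : Fin (M₂ + M₂) → v.adicCompletion (Fp L),
          ((((MpPsi.toOp _ (boxLoc (Fp L) v M₂ M₂ (T₁ := T₁) (T₂ := T₂) (p₁, p₂))
              ((frameOp (Fp L) v ((M₂ + M₂) + (M₂ + M₂)) PD).symm
                (MpPsi.toRep (localSchrodinger (Fp L) ((M₂ + M₂) + (M₂ + M₂))
                  (gramD (Fp L) (M₂ + M₂) (gramR L e' dV hdV (tensorFrame L dW eW dV') (tensorFrame_real L dW hdW eW dV' hdV'))) v)
                ((localSplittingDatumCM L v μ (M₂ + M₂)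
                  (gramR_isSymm L e' dV hdV (tensorFrame L dW eW dV') (tensorFrame_real L dW hdW eW dV' hdV')) hT₀d
                  (hermD_eq_map_gramD L e' dV hdV (tensorFrame L dW eW dV') (tensorFrame_real L dW hdW eW dV' hdV')) χ hχ).localSplitting
                  (tensorEmbLoc L e dV hdV dW hdW eW e' dV' hdV' v
                    (w₁ * FrameTransport.frameConj (Fp L) L (IsCMField.complexConj L) v (2 + 2) (hermD_eq_map_gramD L e dV hdV dW hdW)
                        (antidiagonal_over_eq_map (Fp L) L 2) Q hQ
                        (toLocalFour (Fp L) L (IsCMField.complexConj L) v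
                          (weylTwo (UnitaryGroup.LocalRing L v) (UnitaryGroup.conjLocal L (IsCMField.complexConj L) v))) * g))) Φ))) :
              SchwartzBruhat (Fin ((M₂ + M₂) + (M₂ + M₂)) → v.adicCompletion (Fp L)))) :
            (Fin ((M₂ + M₂) + (M₂ + M₂)) → v.adicCompletion (Fp L)) → ℂ) (glue (blkIdx M₂ M₂) s (0 : Fin (M₂ + M₂) → v.adicCompletion (Fp L))) ∂ν := by
  haveI : Algebra.IsQuadraticExtension (Fp L) L := IsCMField.isQuadraticExtension L
  obtain ⟨c, hc, hword⟩ := exists_ne_zero_swSectionTensorLoc_weylTwo_uLongTwo_mul_eq_integral L e dV hdV dW hdW eW e' dV' hdV' v μ χ hχ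
    D Dinv hDD Q hQm hQ hDa hDia hw₁ hM₂ hT₀d hσ₀ hσ₁ P hPσ hP t' hT' hT₀'d hPD m₀ hm₀ hM₂' t₁ hT₁t hT₁ hT₂ hT₁d hT₂d hTv₁ p₁ hp₁ B₁ hW₁ hm p₂ hp₂
  refine ⟨c, hc, fun g Φ => ?_⟩
  -- the slice `Ψ := VEC_g(· ⊔ 0)` is Schwartz–Bruhat
  set V : SchwartzBruhat (Fin ((M₂ + M₂) + (M₂ + M₂)) → v.adicCompletion (Fp L)) := ((MpPsi.toOp _ (boxLoc (Fp L) v M₂ M₂ (T₁ := T₁) (T₂ := T₂) (p₁, p₂))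
              ((frameOp (Fp L) v ((M₂ + M₂) + (M₂ + M₂)) PD).symm
                (MpPsi.toRep (localSchrodinger (Fp L) ((M₂ + M₂) + (M₂ + M₂))
                  (gramD (Fp L) (M₂ + M₂) (gramR L e' dV hdV (tensorFrame L dW eW dV') (tensorFrame_real L dW hdW eW dV' hdV'))) v)
                ((localSplittingDatumCM L v μ (M₂ + M₂)
                  (gramR_isSymm L e' dV hdV (tensorFrame L dW eW dV') (tensorFrame_real L dW hdW eW dV' hdV')) hT₀d
                  (hermD_eq_map_gramD L e' dV hdV (tensorFrame L dW eW dV') (tensorFrame_real L dW hdW eW dV' hdV')) χ hχ).localSplitting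
                  (tensorEmbLoc L e dV hdV dW hdW eW e' dV' hdV' v
                    (w₁ * FrameTransport.frameConj (Fp L) L (IsCMField.complexConj L) v (2 + 2) (hermD_eq_map_gramD L e dV hdV dW hdW)
                        (antidiagonal_over_eq_map (Fp L) L 2) Q hQ
                        (toLocalFour (Fp L) L (IsCMField.complexConj L) v
                          (weylTwo (UnitaryGroup.LocalRing L v) (UnitaryGroup.conjLocal L (IsCMField.complexConj L) v))) * g))) Φ))) :
              SchwartzBruhat (Fin ((M₂ + M₂) + (M₂ + M₂)) → v.adicCompletion (Fp L))) with hVdef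
  have hΨ : (fun s : Fin (M₂ + M₂) → v.adicCompletion (Fp L) =>
      (V : (Fin ((M₂ + M₂) + (M₂ + M₂)) → v.adicCompletion (Fp L)) → ℂ) (glue (blkIdx M₂ M₂) s 0)) ∈
      SchwartzBruhat (Fin (M₂ + M₂) → v.adicCompletion (Fp L)) :=
    sliceL_mem_schwartzBruhat (blkIdx M₂ M₂) V.2 0
  -- pointwise in `y`: the word (★ p864240) and its phase (§1)
  have hpt : ∀ y : v.adicCompletion (Fp L),
      swSectionTensorLoc L e dV hdV dW hdW eW e' dV' hdV' v
          (localSplittingDatumCM L v μ (M₂ + M₂)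
            (gramR_isSymm L e' dV hdV (tensorFrame L dW eW dV') (tensorFrame_real L dW hdW eW dV' hdV')) hT₀d
            (hermD_eq_map_gramD L e' dV hdV (tensorFrame L dW eW dV') (tensorFrame_real L dW hdW eW dV' hdV')) χ hχ).localSplitting
          m₀ Φ
          (FrameTransport.frameConj (Fp L) L (IsCMField.complexConj L) v (2 + 2) (hermD_eq_map_gramD L e dV hdV dW hdW) (antidiagonal_over_eq_map (Fp L) L 2) Q hQ
              (toLocalFour (Fp L) L (IsCMField.complexConj L) v
                (weylTwo (UnitaryGroup.LocalRing L v) (UnitaryGroup.conjLocal L (IsCMField.complexConj L) v))) *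
            FrameTransport.frameConj (Fp L) L (IsCMField.complexConj L) v (2 + 2) (hermD_eq_map_gramD L e dV hdV dW hdW) (antidiagonal_over_eq_map (Fp L) L 2) Q hQ
              (toLocalFour (Fp L) L (IsCMField.complexConj L) v
                (uLongTwo (UnitaryGroup.LocalRing L v) (UnitaryGroup.conjLocal L (IsCMField.complexConj L) v)
                  (UnitaryGroup.toLocalRing L v y * algebraMap L (UnitaryGroup.LocalRing L v) δ) (conjLocal_toLocalRing_mul_delta L v hcδ y))) * g) =
        c * ∫ x₁ : Fin (M₂ + M₂) → v.adicCompletion (Fp L),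
          (V : (Fin ((M₂ + M₂) + (M₂ + M₂)) → v.adicCompletion (Fp L)) → ℂ) (glue (blkIdx M₂ M₂) x₁ 0) *
            ((adeleAddCharAt (Fp L) v (y * Qc x₁) : Circle) : ℂ) ∂(Measure.pi fun _ : Fin (M₂ + M₂) => μ) := by
    intro y
    have ht := skew_cornerYBlock L e dV hdV dW hdW v D Dinv hDD Q hQm hQ hDa hDia hw₁ _ (conjLocal_toLocalRing_mul_delta L v hcδ y)
    obtain ⟨tb, htb, hPX⟩ := exists_blockSkew L e dV hdV dW hdW v eW e' dV' hdV' P hP _ ht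
    rw [hword _ (conjLocal_toLocalRing_mul_delta L v hcδ y) tb htb hPX g Φ]
    congr 1
    refine integral_congr_ae (Filter.Eventually.of_forall fun x₁ => ?_)
    dsimp only
    rw [coe_unipOpPi_apply, neg_halfForm_cOfFix_boxConj_eq_mul L e dV hdV dW hdW eW e' dV' hdV' v hT₁ hT₂ P hP hPD _ y ht tb htb hPX,
      ← hQc x₁, hVdef, mul_comm]
  -- integrate in `y`: clause (1) of `ν` at the slice
  calc _ = ∫ y : v.adicCompletion (Fp L), c * ∫ x₁ : Fin (M₂ + M₂) → v.adicCompletion (Fp L),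
          (V : (Fin ((M₂ + M₂) + (M₂ + M₂)) → v.adicCompletion (Fp L)) → ℂ) (glue (blkIdx M₂ M₂) x₁ 0) *
            ((adeleAddCharAt (Fp L) v (y * Qc x₁) : Circle) : ℂ) ∂(Measure.pi fun _ : Fin (M₂ + M₂) => μ) ∂μ :=
        integral_congr_ae (Filter.Eventually.of_forall hpt)
    _ = c * ∫ s, (V : (Fin ((M₂ + M₂) + (M₂ + M₂)) → v.adicCompletion (Fp L)) → ℂ) (glue (blkIdx M₂ M₂) s 0) ∂ν := by
        rw [integral_const_mul, (hν _ hΨ).2]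

/-! ## §3 (ED. 2) The corner phase `Qc` IS a quadratic form on the cone slot -/

omit [MeasurableSpace (v.adicCompletion (Fp L))] [BorelSpace (v.adicCompletion (Fp L))] in
include hDD Q hQm hQ hDa hDia hw₁ hcδ in
set_option maxHeartbeats 4000000 in -- MEASURED class of §1 (★ (C3-d)'s `frameMp` letters)
/-- **THE CORNER PHASE IS A QUADRATIC FORM.**  The `y`-free reading `Qc(x₁) = −⅟2·im(2·tr(gramS₂ · t_δ · G̃_{j̃(p₁,p₂)}(x₁ ⊔ 0)))` of §2's letter `hQc` is the
coercion of a Mathlib `QuadraticForm` on `L⁺_v^{M₂+M₂}`: at `y = 1` it is `−halfForm (mulVecLin c_{tb₁}) (x₁ ⊔ 0) = −½⟨x₁ ⊔ 0, c_{tb₁}(x₁ ⊔ 0)⟩` for ONE block-side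
skew `tb₁` (★ `exists_blockSkew` ∘ ★ `skew_cornerYBlock`, §1), a second-degree function of a linear map restricted to the block — ★ Lit `exists_quadraticForm_coe_eq`
(`β := dotProductBilin`, `c₀ := mulVecLin c_{tb₁}`).  So ★ p864508 (an-1) B `exists_nullConeMeasure` applies to `Q := Qf` once its polar form is separating ((D)).
[cite: Weil1964, n° 13, p. 160] [cite: Rangarao1993, Lemma 3.2 (3.8), p. 351] -/
theorem exists_quadraticForm_conePhase
    {T₁ T₂ : Matrix (Fin M₂) (Fin M₂) (Fp L)} (hT₁ : T₁.IsSymm) (hT₂ : T₂.IsSymm)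
    (P : GL (Fin (M₂ + M₂)) (Fp L))
    (hP : ((P : Matrix (Fin (M₂ + M₂)) (Fin (M₂ + M₂)) (Fp L)))ᵀ *
        gramR L e' dV hdV (tensorFrame L dW eW dV') (tensorFrame_real L dW hdW eW dV' hdV') * (P : Matrix _ _ (Fp L)) =
      UnitaryGroup.finSum M₂ M₂ T₁ T₂)
    {PD : GL (Fin ((M₂ + M₂) + (M₂ + M₂))) (Fp L)} (hPD : PD = UnitaryGroup.reindexGL (e₂ (M₂ + M₂)) (UnitaryGroup.blockDiagGL (P, P)))
    (p₁ : LocalMp (Fp L) (M₂ + M₂) (gramD (Fp L) M₂ T₁) v) (p₂ : LocalMp (Fp L) (M₂ + M₂) (gramD (Fp L) M₂ T₂) v) :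
    ∃ Qf : QuadraticForm (v.adicCompletion (Fp L)) (Fin (M₂ + M₂) → v.adicCompletion (Fp L)),
      ∀ x₁ : Fin (M₂ + M₂) → v.adicCompletion (Fp L), Qf x₁ =
        -(⅟(2 : v.adicCompletion (Fp L)) *
          im (quadraticLocalEquiv L v (IsCMField.complexConj L) (complexConj_imagUnit L) (imagUnit_ne_zero L)).toLinearEquiv.toAddEquiv
            (2 * Matrix.trace (gramS (Fp L) L v 2 (gramR L e dV hdV dW hdW) *
              !![0, 0; 0, (UnitaryGroup.toLocalRing L v).comp (algebraMap (Fp L) (v.adicCompletion (Fp L))) d₂ * algebraMap L (UnitaryGroup.LocalRing L v) δ] *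
              Matrix.of fun j i => ∑ k, ∑ l,
              halfDiff ((eD (Fp L) L (IsCMField.complexConj L) (complexConj_imagUnit L) (imagUnit_ne_zero L) (imagUnit_mul_self L) v (M₂ + M₂)).symm
                  (toLin (Fp L) v
                    (MpPsi.proj _ (frameMp (Fp L) v ((M₂ + M₂) + (M₂ + M₂)) PD (transpose_pd_mul_gramD_mul_pd (Fp L) (M₂ + M₂) P hP hPD)
                      (boxLoc (Fp L) v M₂ M₂ (T₁ := T₁) (T₂ := T₂) (p₁, p₂))))⁻¹
                    (frameLin (Fp L) v ((M₂ + M₂) + (M₂ + M₂)) PD (glue (blkIdx M₂ M₂) x₁ 0), 0))) (epsV e eW e' (j, l)) *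
                gramS (Fp L) L v M₂ (realDiagonal L dV' hdV') k l *
                conjLocal L (IsCMField.complexConj L) v
                  (halfDiff ((eD (Fp L) L (IsCMField.complexConj L) (complexConj_imagUnit L) (imagUnit_ne_zero L) (imagUnit_mul_self L) v (M₂ + M₂)).symm
                    (toLin (Fp L) v
                      (MpPsi.proj _ (frameMp (Fp L) v ((M₂ + M₂) + (M₂ + M₂)) PD (transpose_pd_mul_gramD_mul_pd (Fp L) (M₂ + M₂) P hP hPD)
                        (boxLoc (Fp L) v M₂ M₂ (T₁ := T₁) (T₂ := T₂) (p₁, p₂))))⁻¹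
                      (frameLin (Fp L) v ((M₂ + M₂) + (M₂ + M₂)) PD (glue (blkIdx M₂ M₂) x₁ 0), 0))) (epsV e eW e' (i, k)))))) := by
  haveI : Algebra.IsQuadraticExtension (Fp L) L := IsCMField.isQuadraticExtension L
  -- ONE block-side skew at `y = 1`
  have ht := skew_cornerYBlock L e dV hdV dW hdW v D Dinv hDD Q hQm hQ hDa hDia hw₁ _ (conjLocal_toLocalRing_mul_delta L v hcδ 1)
  obtain ⟨tb, htb, hPX⟩ := exists_blockSkew L e dV hdV dW hdW v eW e' dV' hdV' P hP _ ht
  -- the second-degree function of `c_{tb}` on the block is a quadratic form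
  obtain ⟨Qf, hQf⟩ := exists_quadraticForm_coe_eq (blkIdx M₂ M₂)
    (dotProductBilin (v.adicCompletion (Fp L)) (v.adicCompletion (Fp L)))
    (Matrix.mulVecLin (cOfFix (localGram (Fp L) ((M₂ + M₂) + (M₂ + M₂)) (gramD (Fp L) (M₂ + M₂) (UnitaryGroup.finSum M₂ M₂ T₁ T₂)) v)
      (MpPsi.proj _ (boxLoc (Fp L) v M₂ M₂ (T₁ := T₁) (T₂ := T₂) (p₁, p₂)) *
        iotaD (Fp L) L (IsCMField.complexConj L) (complexConj_imagUnit L) (imagUnit_ne_zero L) (imagUnit_mul_self L) v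
          (M₂ + M₂) (UnitaryGroup.isSymm_finSum hT₁ hT₂) rfl
          (nElem (Fp L) L (IsCMField.complexConj L) v (M₂ + M₂) (T₀ := UnitaryGroup.finSum M₂ M₂ T₁ T₂) rfl tb htb) *
        (MpPsi.proj _ (boxLoc (Fp L) v M₂ M₂ (T₁ := T₁) (T₂ := T₂) (p₁, p₂)))⁻¹)))
  refine ⟨Qf, fun x₁ => ?_⟩
  have h1 := neg_halfForm_cOfFix_boxConj_eq_mul L e dV hdV dW hdW eW e' dV' hdV' v hT₁ hT₂ P hP hPD
    (boxLoc (Fp L) v M₂ M₂ (T₁ := T₁) (T₂ := T₂) (p₁, p₂)) 1 ht tb htb hPX (glue (blkIdx M₂ M₂) x₁ 0)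
  rw [one_mul] at h1
  rw [hQf, ← h1]
  rfl

end Summit.HodgeConjecture.HodgeConjecture.Cruxes.HLiu418.K2LiuConeOuterStage

end
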